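import Summits.Ventures.HSemireg.WedgeHankelOuterFamilyPure
import Summits.Ventures.HSemireg.WedgeHankelSiegelIdealSubBox
import Summits.Ventures.HSemireg.WedgeHankelSiegelIdealKernel
import Summits.Ventures.HSemireg.WedgeHankelSpikes

/-!
# Venture HSemireg — THE EXCESS LAW FOR A FAMILY OF CLASSES AND HOW MANY CLASSES CUT OUT THE SIEGEL IDEAL: on every sub-box the joint kernel of a finite family `(w_N(q_c))_c`
# exceeds the Siegel ideal by `C(|T|,k) · (k + 1 − rank [H_k(q_c)]_c)`; it IS the Siegel ideal iff the block Hankel matrix has full row rank `k + 1`; hence **in degree `k ≤ N` at least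
# `⌈(k+1)/(N+1−k)⌉` classes are needed to cut out `SI_k`, and that many spikes `δ_j` suffice** — one class up to the middle degree (gen 11), `N + 1` classes in the top degree
# (G3/G4: `k + 1` frames or node classes always suffice, `k` frames never; the count here is for ARBITRARY classes, by columns of the block Hankel matrix)

HONEST FRAMING. Part of the Lean index of the computation cell `pub-hsemireg` (seat p10 gen 24, Sunday typer «UNIFORM-IN-n»).
Finite-dimensional EXTERIOR ALGEBRA over a field + ranks of explicit `0/1` block Hankel matrices ONLY: no variety, no cohomology theory, no sheaf, no Ext group, no semiregularity map;
nothing here says that HC / HC_CM / HC_AV holds; no Literature fact is declared or used.  Custodian versions as in `WedgeHankelSiegelIdeal` (1/3); the dictionary (`SI_k` = th-6's «Θ-isotropic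
part»; `δ_j` = the class `Θ^j/j!`; a family of classes = several polarisation-type classes of one box tested at once) is QUOTED, never asserted.

WHAT IS IN THE TREE.  Gen 11 (`WedgeHankelSiegelIdeal*`): `siegelIdeal_le_exteriorPower`, `mul_w_eq_zero_of_mem_siegelIdeal`, `finrank_siegelIdeal` (`dim SI_k + (k+1)·C(n,k) = C(2n,k)`),
`ker_wedge_delta_eq_siegelIdeal` (ONE class `δ_k` cuts out `SI_k` when `2k ≤ n`), `iInf_ker_wedge_w_eq_siegelIdeal` (`2k ≤ n`); G6 `siegelIdeal_eq_iInf_Kr_w` (ALL classes, `k ≤ n`); J1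
(`WedgeHankelOuterFamily`): `finrank_iInf_Kr_w_inf_Sp_pairs_add`, `finrank_iInf_Kr_w_top_add` (the joint kernel law); L12 (`WedgeHankelSiegelIdealSubBox`): `finrank_siegelIdeal_inf_Sp_pairs_add`,
`siegelIdeal_inf_Sp_pairs_le_Kr`; G3/G4 (`WedgeHankelFrameIntersection`, `WedgeHankelDivisorIntersection`): `SI_k` is cut out by any `k + 1` frames / by the node classes of any
divisor of total order `≥ k + 1`, and `k` frames never do; th-7's block Hankel matrix `hank` (`WedgeHankelTuples`); `spikeSeq` (`WedgeHankelSpikes`).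
THIS FILE (namespace `Summit.Ventures.HSemireg.Wedge.HankelOuter` continued):
* §404 `siegelIdeal_le_Hom_iInf_Kr_w` (the Siegel ideal lies in every joint kernel), `siegelIdeal_inf_Sp_pairs_le_Hom_iInf_Kr_w`, `rank_hank_le_succ` (`rank [H_k(q_c)]_c ≤ k + 1`),
  **`rank_hank_le_card_mul`** (`rank [H_k(q_c)]_c ≤ |ι| · (N + 1 − k)`: each class brings `N + 1 − k` columns).
* §405 THE EXCESS LAW FOR FAMILIES: **`finrank_Hom_iInf_Kr_w_inf_Sp_pairs_eq_siegelIdeal_add`** (`dim (Hom(univ,k) ⊓ ⋂_c Kr ⊓ Sp(pairs ⊆ T)) + C(|T|,k)·rank [H_k(q_c)]_c = dim (SI_k ⊓ Sp(pairs ⊆ T))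
  + (k+1)·C(|T|,k)` on EVERY sub-box), **`Hom_iInf_Kr_w_inf_Sp_pairs_eq_siegelIdeal_inf_iff`** (`= SI_k ⊓ Sp(pairs ⊆ T) ↔ |T| < k ∨ rank = k + 1`); full box:
  `finrank_Hom_iInf_Kr_w_eq_siegelIdeal_add`, **`Hom_iInf_Kr_w_eq_siegelIdeal_iff`** (`Hom(univ,k) ⊓ ⋂_c Kr(univ, w_N q_c, k) = SI_k ↔ N < k ∨ rank [H_k(q_c)]_c = k + 1`).
* §406 HOW MANY CLASSES ARE NEEDED: **`Hom_iInf_Kr_w_ne_siegelIdeal_of_card_mul_lt`** (`k ≤ N`, `|ι|·(N+1−k) < k+1` ⇒ the joint kernel is STRICTLY bigger than `SI_k`, for EVERY family of `|ι|`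
  classes), `finrank_Hom_iInf_Kr_w_ge` (the defect is at least `C(N,k)·(k + 1 − |ι|(N+1−k))`); top degree: `Hom_iInf_Kr_w_top_ne_siegelIdeal_of_card_le` (`|ι| ≤ N` classes never cut out `SI_N`).
* §407 THAT MANY SPIKES SUFFICE: `hank_spike_apply`; **`rank_hank_spikes_cover`** (the `m` spikes `δ_{min(k, (N−k) + (N+1−k)·l)}`, `l < m`, have joint rank `k + 1` as soon as
  `(N+1−k)·m ≥ k+1`: the windows of rows they hit tile `{0, …, k}`) and **`Hom_iInf_Kr_w_spikes_cover_eq_siegelIdeal`**: `⌈(k+1)/(N+1−k)⌉` CLASSES CUT OUT `SI_k`, the bound of §406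
  attained (G4 §92 gives `k + 1` node classes — e.g. `δ_0, …, δ_k` — and G3 shows `k` PURE classes never suffice; the economy here comes from spikes `δ_j`, `N − k ≤ j ≤ k`, whose
  Hankel matrices have the full column rank `N + 1 − k`).
READING: gen 11's «one class detects the isotropic part up to the middle degree» and G6's «all classes detect it in every degree» are the two ends of one law: in degree `k` of a box
of `N` pairs exactly `⌈(k+1)/(N+1−k)⌉` classes are necessary and (spikes) sufficient — `1` for `2k ≤ N`, `2` up to `k ≤ (2N+1)/3`, …, `N + 1` in the top degree.  Nothing Ext-side.
New names only.
-/

open Module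

namespace Summit.Ventures.HSemireg.Wedge.HankelOuter

open Summit.Ventures.HSemireg.Wedge Summit.Ventures.HSemireg.Wedge.Kunneth Summit.Ventures.HSemireg.Wedge.Hankel
  Summit.Ventures.HSemireg.Wedge.BasisFree Summit.Ventures.HSemireg.Wedge.HankelSiegel Summit.Ventures.HSemireg.Wedge.HankelSiegelIdeal
  Summit.Ventures.HSemireg.Wedge.KunnethKernel Summit.Ventures.HSemireg.Wedge.HankelFrameChange Summit.Ventures.HSemireg.Wedge.Weil
  Summit.Ventures.HSemireg.Wedge.HankelPairMixing Summit.Ventures.HSemireg.Wedge.HankelPairGrading Summit.Ventures.HSemireg.Wedge.HankelSpikes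

variable (K : Type*) [Field K] {N : ℕ} {ι : Type} [Fintype ι] [DecidableEq ι]

/-! ## §404. The Siegel ideal lies in every joint kernel; the row and column bounds on the block Hankel rank -/

omit [Fintype ι] [DecidableEq ι] in
/-- **the Siegel ideal lies in every joint kernel: `SI_k ≤ Hom(univ,k) ⊓ ⋂_c Kr(univ, w_N q_c, k)`** (every family `q`, every `k`, every field). -/
theorem siegelIdeal_le_Hom_iInf_Kr_w (k : ℕ) (q : ι → ℕ → K) :
    siegelIdeal K N k ≤ Hom K (In N) (Finset.univ : Finset (In N)) k ⊓ ⨅ c, Kr K (Finset.univ : Finset (In N)) (w K N N (q c)) k := by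
  have hH : siegelIdeal K N k ≤ Hom K (In N) (Finset.univ : Finset (In N)) k := by
    rw [← exteriorPower_eq_Hom_univ]
    exact siegelIdeal_le_exteriorPower K k
  exact le_inf hH (le_iInf fun c _ hθ => mem_Kr.mpr ⟨hH hθ, mul_w_eq_zero_of_mem_siegelIdeal K hθ (q c)⟩)

omit [Fintype ι] [DecidableEq ι] in
/-- … and on every sub-box: `SI_k ⊓ Sp(pairs ⊆ T) ≤ Hom(univ,k) ⊓ ⋂_c Kr(univ, w_N q_c, k) ⊓ Sp(pairs ⊆ T)`. -/
theorem siegelIdeal_inf_Sp_pairs_le_Hom_iInf_Kr_w (T : Finset (Fin N)) (k : ℕ) (q : ι → ℕ → K) :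
    siegelIdeal K N k ⊓ Sp K (fun s : Finset (In N) => ∀ i ∈ s, pr i ∈ T)
      ≤ Hom K (In N) (Finset.univ : Finset (In N)) k ⊓ (⨅ c, Kr K (Finset.univ : Finset (In N)) (w K N N (q c)) k) ⊓ Sp K (fun s : Finset (In N) => ∀ i ∈ s, pr i ∈ T) :=
  inf_le_inf (siegelIdeal_le_Hom_iInf_Kr_w K k q) le_rfl

omit [DecidableEq ι] in
/-- the row bound: `rank [H_k(q_c)]_c ≤ k + 1`. -/
theorem rank_hank_le_succ (k : ℕ) (q : ι → ℕ → K) : (hank K N k (fun (_ : Unit) (c : ι) => q c)).rank ≤ k + 1 :=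
  le_trans (Matrix.rank_le_card_height _) (by rw [Fintype.card_prod, Fintype.card_unique, Fintype.card_fin, one_mul])

omit [DecidableEq ι] in
/-- **the column bound: `rank [H_k(q_c)]_c ≤ |ι| · (N + 1 − k)`** — each class contributes the `N + 1 − k` columns of its own Hankel matrix. -/
theorem rank_hank_le_card_mul (k : ℕ) (q : ι → ℕ → K) : (hank K N k (fun (_ : Unit) (c : ι) => q c)).rank ≤ Fintype.card ι * (N + 1 - k) :=
  le_trans (Matrix.rank_le_card_width _) (by rw [Fintype.card_prod, Fintype.card_fin])

/-! ## §405. The excess law for a family of classes -/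

/-- **THE EXCESS LAW FOR A FAMILY ON EVERY SUB-BOX:
`dim (Hom(univ,k) ⊓ ⋂_c Kr(univ, w_N q_c, k) ⊓ Sp(pairs ⊆ T)) + C(|T|,k) · rank [H_k(q_c)]_c = dim (SI_k ⊓ Sp(pairs ⊆ T)) + (k+1) · C(|T|,k)`** (every finite family, every `T`, `k`,
field): the joint kernel exceeds the Siegel ideal by `C(|T|,k)` copies of the row-corank of the block Hankel matrix. -/
theorem finrank_Hom_iInf_Kr_w_inf_Sp_pairs_eq_siegelIdeal_add (T : Finset (Fin N)) (k : ℕ) (q : ι → ℕ → K) :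
    finrank K ↥(Hom K (In N) (Finset.univ : Finset (In N)) k ⊓ (⨅ c, Kr K (Finset.univ : Finset (In N)) (w K N N (q c)) k) ⊓ Sp K (fun s : Finset (In N) => ∀ i ∈ s, pr i ∈ T))
        + T.card.choose k * (hank K N k (fun (_ : Unit) (c : ι) => q c)).rank
      = finrank K ↥(siegelIdeal K N k ⊓ Sp K (fun s : Finset (In N) => ∀ i ∈ s, pr i ∈ T)) + (k + 1) * T.card.choose k := by
  rw [finrank_iInf_Kr_w_inf_Sp_pairs_add, finrank_siegelIdeal_inf_Sp_pairs_add]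

/-- **THE FULL-RANK CRITERION FOR A FAMILY ON A SUB-BOX: `Hom(univ,k) ⊓ ⋂_c Kr(univ, w_N q_c, k) ⊓ Sp(pairs ⊆ T) = SI_k ⊓ Sp(pairs ⊆ T) ↔ |T| < k ∨ rank [H_k(q_c)]_c = k + 1`.** -/
theorem Hom_iInf_Kr_w_inf_Sp_pairs_eq_siegelIdeal_inf_iff (T : Finset (Fin N)) (k : ℕ) (q : ι → ℕ → K) :
    Hom K (In N) (Finset.univ : Finset (In N)) k ⊓ (⨅ c, Kr K (Finset.univ : Finset (In N)) (w K N N (q c)) k) ⊓ Sp K (fun s : Finset (In N) => ∀ i ∈ s, pr i ∈ T)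
        = siegelIdeal K N k ⊓ Sp K (fun s : Finset (In N) => ∀ i ∈ s, pr i ∈ T)
      ↔ T.card < k ∨ (hank K N k (fun (_ : Unit) (c : ι) => q c)).rank = k + 1 := by
  have h := finrank_Hom_iInf_Kr_w_inf_Sp_pairs_eq_siegelIdeal_add K T k q
  have hle := siegelIdeal_inf_Sp_pairs_le_Hom_iInf_Kr_w K T k q
  have hrk := rank_hank_le_succ K (N := N) k q
  constructor
  · intro he
    rw [he] at h
    by_cases hT : T.card < k
    · exact Or.inl hT
    · right
      have hpos : 0 < T.card.choose k := Nat.choose_pos (not_lt.mp hT)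
      have h2 : T.card.choose k * (hank K N k (fun (_ : Unit) (c : ι) => q c)).rank = T.card.choose k * (k + 1) := by
        rw [mul_comm (T.card.choose k) (k + 1)]; omega
      exact Nat.eq_of_mul_eq_mul_left hpos h2
  · rintro (hT | hr)
    · refine (Submodule.eq_of_le_of_finrank_eq hle ?_).symm
      rw [Nat.choose_eq_zero_of_lt hT, zero_mul, mul_zero, add_zero, add_zero] at h
      exact h.symm
    · refine (Submodule.eq_of_le_of_finrank_eq hle ?_).symm
      rw [hr, mul_comm] at h
      omega

/-- **THE EXCESS LAW FOR A FAMILY (full box): `dim (Hom(univ,k) ⊓ ⋂_c Kr(univ, w_N q_c, k)) + C(N,k) · rank [H_k(q_c)]_c = dim SI_k + (k+1) · C(N,k)`.** -/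
theorem finrank_Hom_iInf_Kr_w_eq_siegelIdeal_add (k : ℕ) (q : ι → ℕ → K) :
    finrank K ↥(Hom K (In N) (Finset.univ : Finset (In N)) k ⊓ ⨅ c, Kr K (Finset.univ : Finset (In N)) (w K N N (q c)) k)
        + N.choose k * (hank K N k (fun (_ : Unit) (c : ι) => q c)).rank
      = finrank K ↥(siegelIdeal K N k) + (k + 1) * N.choose k := by
  have h1 := finrank_iInf_Kr_w_top_add K (N := N) k q
  have h2 := finrank_siegelIdeal K (n := N) k
  omega

/-- **THE FULL-RANK CRITERION FOR A FAMILY: `Hom(univ,k) ⊓ ⋂_c Kr(univ, w_N q_c, k) = SI_k ↔ N < k ∨ rank [H_k(q_c)]_c = k + 1`** (every finite family of classes of the box, every `k`,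
every field) — gen 11's criterion for one class with the block Hankel matrix of the family. -/
theorem Hom_iInf_Kr_w_eq_siegelIdeal_iff (k : ℕ) (q : ι → ℕ → K) :
    Hom K (In N) (Finset.univ : Finset (In N)) k ⊓ (⨅ c, Kr K (Finset.univ : Finset (In N)) (w K N N (q c)) k) = siegelIdeal K N k
      ↔ N < k ∨ (hank K N k (fun (_ : Unit) (c : ι) => q c)).rank = k + 1 := by
  have h := finrank_Hom_iInf_Kr_w_eq_siegelIdeal_add K (N := N) k q
  have hle := siegelIdeal_le_Hom_iInf_Kr_w K (N := N) k q
  have hrk := rank_hank_le_succ K (N := N) k q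
  constructor
  · intro he
    rw [he] at h
    by_cases hN : N < k
    · exact Or.inl hN
    · right
      have hpos : 0 < N.choose k := Nat.choose_pos (not_lt.mp hN)
      have h2 : N.choose k * (hank K N k (fun (_ : Unit) (c : ι) => q c)).rank = N.choose k * (k + 1) := by
        rw [mul_comm (N.choose k) (k + 1)]; omega
      exact Nat.eq_of_mul_eq_mul_left hpos h2
  · rintro (hN | hr)
    · refine (Submodule.eq_of_le_of_finrank_eq hle ?_).symm
      rw [Nat.choose_eq_zero_of_lt hN, zero_mul, mul_zero, add_zero, add_zero] at h
      exact h.symm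
    · refine (Submodule.eq_of_le_of_finrank_eq hle ?_).symm
      rw [hr, mul_comm] at h
      omega

/-! ## §406. How many classes are needed to cut out the Siegel ideal -/

omit [DecidableEq ι] in
/-- **TOO FEW CLASSES NEVER CUT OUT THE SIEGEL IDEAL: if `k ≤ N` and `|ι| · (N + 1 − k) < k + 1` then `Hom(univ,k) ⊓ ⋂_c Kr(univ, w_N q_c, k) ≠ SI_k` for EVERY family `(q_c)_{c ∈ ι}`**
(the block Hankel matrix has fewer than `k + 1` columns). -/
theorem Hom_iInf_Kr_w_ne_siegelIdeal_of_card_mul_lt {k : ℕ} (hk : k ≤ N) (hι : Fintype.card ι * (N + 1 - k) < k + 1) (q : ι → ℕ → K) :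
    Hom K (In N) (Finset.univ : Finset (In N)) k ⊓ (⨅ c, Kr K (Finset.univ : Finset (In N)) (w K N N (q c)) k) ≠ siegelIdeal K N k := by
  classical
  intro he
  rcases (Hom_iInf_Kr_w_eq_siegelIdeal_iff K k q).mp he with hN | hr
  · omega
  · have := rank_hank_le_card_mul K (N := N) k q
    omega

omit [DecidableEq ι] in
/-- the defect quantified: **`dim (Hom(univ,k) ⊓ ⋂_c Kr(univ, w_N q_c, k)) ≥ dim SI_k + C(N,k) · (k + 1 − |ι| · (N + 1 − k))`** for every family of `|ι|` classes. -/
theorem finrank_Hom_iInf_Kr_w_ge (k : ℕ) (q : ι → ℕ → K) :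
    finrank K ↥(siegelIdeal K N k) + N.choose k * (k + 1 - Fintype.card ι * (N + 1 - k))
      ≤ finrank K ↥(Hom K (In N) (Finset.univ : Finset (In N)) k ⊓ ⨅ c, Kr K (Finset.univ : Finset (In N)) (w K N N (q c)) k) := by
  classical
  have h := finrank_Hom_iInf_Kr_w_eq_siegelIdeal_add K (N := N) k q
  have hr := rank_hank_le_card_mul K (N := N) k q
  have hr1 := rank_hank_le_succ K (N := N) k q
  have h3 : N.choose k * (k + 1 - Fintype.card ι * (N + 1 - k)) + N.choose k * (hank K N k (fun (_ : Unit) (c : ι) => q c)).rank ≤ N.choose k * (k + 1) := by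
    rw [← mul_add]
    exact Nat.mul_le_mul_left _ (by omega)
  have h4 : (k + 1) * N.choose k = N.choose k * (k + 1) := mul_comm _ _
  omega

omit [DecidableEq ι] in
/-- top degree: **`N` classes or fewer never cut out `SI_N`** (`H_N(q)` is a single column): `Hom(univ,N) ⊓ ⋂_c Kr(univ, w_N q_c, N) ≠ SI_N` whenever `|ι| ≤ N`. -/
theorem Hom_iInf_Kr_w_top_ne_siegelIdeal_of_card_le (hι : Fintype.card ι ≤ N) (q : ι → ℕ → K) :
    Hom K (In N) (Finset.univ : Finset (In N)) N ⊓ (⨅ c, Kr K (Finset.univ : Finset (In N)) (w K N N (q c)) N) ≠ siegelIdeal K N N :=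
  Hom_iInf_Kr_w_ne_siegelIdeal_of_card_mul_lt K le_rfl (by rw [show N + 1 - N = 1 by omega, mul_one]; omega) q

/-! ## §407. That many spikes suffice -/

omit [Fintype ι] [DecidableEq ι] in
/-- entries of the block Hankel matrix of a family of spikes: `[H_k(δ_{p_c})]_c ((), i) (c, t) = [i + t = p_c]`. -/
theorem hank_spike_apply (k : ℕ) (p : ι → ℕ) (i : Fin (k + 1)) (c : ι) (t : Fin (N + 1 - k)) :
    hank K N k (fun (_ : Unit) (c : ι) => spikeSeq K (p c)) ((), i) (c, t) = if (i : ℕ) + t = p c then 1 else 0 := by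
  simp only [hank, hank', Matrix.of_apply, spikeSeq_apply]

/-- **`⌈(k+1)/(N+1−k)⌉` SPIKES HAVE FULL JOINT RANK: for `k ≤ N` and `(N + 1 − k) · m ≥ k + 1` the spikes `δ_{p_l}`, `p_l = min k ((N − k) + (N + 1 − k)·l)`, `l < m`, satisfy
`rank [H_k(δ_{p_l})]_l = k + 1`** — the windows `[p_l − (N−k), p_l]` of rows hit by the classes tile `{0, …, k}` (the last one pushed back inside). -/
theorem rank_hank_spikes_cover {k m : ℕ} (hk : k ≤ N) (hm : k + 1 ≤ (N + 1 - k) * m) :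
    (hank K N k (fun (_ : Unit) (l : Fin m) => spikeSeq K (min k ((N - k) + (N + 1 - k) * l)))).rank = k + 1 := by
  apply le_antisymm (rank_hank_le_succ K (N := N) k _)
  have hD : 0 < N + 1 - k := by omega
  -- row `i` is hit by class `l = i / (N+1−k)` in column `t = p_l − i`
  have hl : ∀ i : Fin (k + 1), (i : ℕ) / (N + 1 - k) < m := by
    intro i
    have h1 := Nat.div_add_mod (i : ℕ) (N + 1 - k)
    have h3 : (N + 1 - k) * ((i : ℕ) / (N + 1 - k)) < (N + 1 - k) * m := by omega
    exact Nat.lt_of_mul_lt_mul_left h3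
  have ht : ∀ i : Fin (k + 1), (i : ℕ) ≤ min k ((N - k) + (N + 1 - k) * ((i : ℕ) / (N + 1 - k)))
      ∧ min k ((N - k) + (N + 1 - k) * ((i : ℕ) / (N + 1 - k))) - (i : ℕ) < N + 1 - k := by
    intro i
    have h1 := Nat.div_add_mod (i : ℕ) (N + 1 - k)
    have h2 := Nat.mod_lt (i : ℕ) hD
    have hi := i.2
    constructor
    · apply le_min (by omega)
      omega
    · omega
  let r : Fin (k + 1) → Unit × Fin (k + 1) := fun i => ((), i)
  let c : Fin (k + 1) → Fin m × Fin (N + 1 - k) := fun i =>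
    (⟨(i : ℕ) / (N + 1 - k), hl i⟩, ⟨min k ((N - k) + (N + 1 - k) * ((i : ℕ) / (N + 1 - k))) - (i : ℕ), (ht i).2⟩)
  have hsub : (hank K N k (fun (_ : Unit) (l : Fin m) => spikeSeq K (min k ((N - k) + (N + 1 - k) * l)))).submatrix r c = 1 := by
    ext i j
    simp only [Matrix.submatrix_apply, hank_spike_apply, Matrix.one_apply, Fin.ext_iff, r, c]
    have hj := (ht j).1
    by_cases hij : (i : ℕ) = (j : ℕ)
    · rw [if_pos (by omega), if_pos hij]
    · rw [if_neg (by omega), if_neg hij]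
  have h := Matrix.rank_submatrix_le (hank K N k (fun (_ : Unit) (l : Fin m) => spikeSeq K (min k ((N - k) + (N + 1 - k) * l)))) r c
  rw [hsub, Matrix.rank_one, Fintype.card_fin] at h
  exact h

/-- **`⌈(k+1)/(N+1−k)⌉` CLASSES CUT OUT THE SIEGEL IDEAL: for `k ≤ N` and `(N + 1 − k) · m ≥ k + 1`,
`Hom(univ,k) ⊓ ⋂_{l < m} Kr(univ, w_N δ_{p_l}, k) = SI_k`**, `p_l = min k ((N − k) + (N + 1 − k)·l)` — the bound of §406 is attained: one class for `2k ≤ N` (gen 11), two up to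
`3k ≤ 2N + 1`, …, `N + 1` classes in the top degree. -/
theorem Hom_iInf_Kr_w_spikes_cover_eq_siegelIdeal {k m : ℕ} (hk : k ≤ N) (hm : k + 1 ≤ (N + 1 - k) * m) :
    Hom K (In N) (Finset.univ : Finset (In N)) k
        ⊓ (⨅ l : Fin m, Kr K (Finset.univ : Finset (In N)) (w K N N (spikeSeq K (min k ((N - k) + (N + 1 - k) * l)))) k) = siegelIdeal K N k :=
  (Hom_iInf_Kr_w_eq_siegelIdeal_iff K k (fun (l : Fin m) => spikeSeq K (min k ((N - k) + (N + 1 - k) * l)))).mpr (Or.inr (rank_hank_spikes_cover K hk hm))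

end Summit.Ventures.HSemireg.Wedge.HankelOuter
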